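import Literature.NumberTheory.LFunctions.BurnolHardyRightTools
import Literature.NumberTheory.LFunctions.SonineMellinFunctionalEquation
import Literature.NumberTheory.LFunctions.BurnolSonineFourier
import Literature.NumberTheory.LFunctions.BurnolSonineHardyStrip
import HarnessLib

/-!
# Burnol 2004b, Lemma 4.4 from the (repaired) Prop. 4.1: `F ∈ K̂_a ⇒ F(s)/s ∈ L̂_a`

LINE 1 — LABEL: RH-FREE (function-theoretic bookkeeping on the Sonine spaces `K_a ⊂ L_a`; no
hypothesis and no conclusion about zeros of `ζ`). FRAMING (cell rh-crit, D-0074): corpus theorems are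
RH-FREE literature; nothing here is worded as progress toward RH. bears_on: B-C/B-P (LADDER-RH
COLUMN 6, de Branges framework). WHAT THIS IS NOT: not a route, not a criterion; the Paley–Wiener step
(Prop. 4.1 (ii), typed pole-tolerantly as `Burnol2004b_prop4_1R`) is an INPUT here, not proved;
nothing here bears on the truth of RH.

Burnol, Lemma 4.4 (TeX l.746–758): "If `F(s)` belongs to `K̂_a` then `F(s)/s` belongs to `L̂_a`.
Proof. The function `F(s)/s` (which is regular at `s = 0`) belongs to the space `A^s ℍ²`, simply from
`1/|s| = O(1)` on `Re(s) ≥ 1/2`. Its image under the Fourier transform is `𝓕₊(F)(s)/(1−s)` which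
belongs to `(s/(s−1))A^s ℍ²`." — and then Prop. 4.1 (ii). This module assembles exactly that:

* `G(s) = F(s)/s` is `dslope G_f 0` for the ENTIRE continuation `G_f` of `f̂`, `f ∈ K_a`, which
  vanishes at `0` (`Burnol2004b_thm2_1_holds`); `H(s) = G_{𝓕f}(s)/(1−s)` (`𝓕f ∈ K_a`,
  `fourier_mem_sonineK`); the `Γ_ℝ`-relation `Γ_ℝ(s)H(s) = Γ_ℝ(1−s)G(1−s)` is the functional
  equation `𝒢_{𝓕f}(s) = 𝒢_f(1−s)` of the entire completed transforms
  (`completedMellinEntire_fourier_eq_of_mem_sonineK`) once `𝒢_f = Γ_ℝ·G_f` off the poles of `Γ_ℝ`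
  (`completedMellinEntire_eq_Gammaℝ_mul`, identity theorem on the connected set `ℂ ∖ {0,−2,−4,…}`);
* the `ℍ²`-members: from clause (i) of `Burnol2004b_prop4_1R` (`a^s((s−1)/s)f̂ ∈ ℍ²`, continued to
  the half-plane by the identity theorem) via `IsHardyRight.div_id` ("`1/|s| = O(1)`"), and for the
  Fourier side `−a^s G_{𝓕f}(s)/s = −F₂(s)/(s−1)` via `IsHardyRight.of_le_off_rect` around `s = 1`
  (`G_{𝓕f}` is entire, so no pole: the factor `(s−1)/s` of the `L_a`-normalisation is undone).

## Main results (all PROVED; no definition, no named fact)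

* `BurnolSonineHardy.completedMellinEntire_eq_Gammaℝ_mul` — for `f ∈ K_a` and any entire
  continuation `G` of `f̂`: `𝒢_f(s) = Γ_ℝ(s)·G(s)` wherever `Γ_ℝ(s) ≠ 0`.
* `BurnolSonineHardy.const_eq_zero_of_continuousAt`, `mem_sonineK_of_continuousAt` — a pole at
  `s = 1` detects the constant on `(0,a)`: if `f̂` (resp. also `(𝓕f)^`) agrees on the strip with a
  function continuous at `1`, the constant of `f` (resp. `f ∈ L_a` lies in `K_a`) — the factor
  `s/(s−1)` of "`ℂ·𝟙_{0<t<a} + L²(a,∞) ≅ (s/(s−1))A^sℍ²`" (TeX l.638–643); for reading `K_a`-membership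
  off Prop. 4.1 (ii)-type conclusions (Prop. 4.3, second clause; Prop. 4.5).
* `BurnolSonineHardy.Burnol2004b_prop4_5_of_exists_pair` — Prop. 4.5 (`dim L_a/K_a = 2`, as typed:
  two vectors independent modulo `K_a` and spanning modulo `K_a`) from the EXISTENCE of two elements of
  `L_a` with linearly independent pairs of constants `((c_u, c'_u), (c_v, c'_v))` — "the subspace `K_a`
  is defined by two linear conditions" (TeX l.772–774); the existence (Burnol: an `F ∈ K̂_a` with
  `F'(0) ≠ 0`, via Lemma 4.4) is the input, not proved here.
* `BurnolSonineHardy.Burnol2004b_lemma4_4_of_prop4_1R_ii` (clause (ii) of `Burnol2004b_prop4_1R` alone ⟹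
  `Burnol2004b_lemma4_4`, clause (i) being the tree theorem `Burnol2004b_prop4_1R_i`) and
  `Burnol2004b_lemma4_4_of_prop4_1R : Burnol2004b_prop4_1R → Burnol2004b_lemma4_4`.

## References

* J.-F. Burnol, *Two complete and minimal systems associated with the zeros of the Riemann zeta
  function*, J. Théor. Nombres Bordeaux 16 (2004) 65–94 = arXiv:math/0203120v7, Lemma 4.4, Thm. 2.1,
  Prop. 4.1 (TeX of record `dbl/src/Burnol2004JTNB_arXivmath0203120v7.tex`, l.437–443, 646–669,
  746–758). [key `Burnol2004b`]
-/

noncomputable section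

open MeasureTheory Complex Filter Set
open scoped Topology FourierTransform

namespace Literature.NumberTheory.LFunctions

namespace BurnolSonineHardy

/-- Identity theorem on the half-plane `Re s > 1/2` from the strip `1/2 < Re s < 1`. [folklore] -/
private theorem eq_of_eq_on_strip {F Φ : ℂ → ℂ} (hF : DifferentiableOn ℂ F {s | 1 / 2 < s.re})
    (hΦ : DifferentiableOn ℂ Φ {s | 1 / 2 < s.re})
    (h : ∀ s : ℂ, 1 / 2 < s.re → s.re < 1 → F s = Φ s) :
    ∀ s : ℂ, 1 / 2 < s.re → F s = Φ s := by
  have hopen : IsOpen {s : ℂ | 1 / 2 < s.re} := isOpen_lt continuous_const Complex.continuous_re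
  have hconn : IsPreconnected {s : ℂ | 1 / 2 < s.re} :=
    (convex_halfSpace_re_gt (1 / 2 : ℝ)).isPreconnected
  have hFa : AnalyticOnNhd ℂ F {s : ℂ | 1 / 2 < s.re} := hF.analyticOnNhd hopen
  have hΦa : AnalyticOnNhd ℂ Φ {s : ℂ | 1 / 2 < s.re} := hΦ.analyticOnNhd hopen
  have h34 : (3 / 4 : ℂ) ∈ {s : ℂ | 1 / 2 < s.re} := by simp; norm_num
  have hstrip : IsOpen {z : ℂ | 1 / 2 < z.re ∧ z.re < 1} :=
    (isOpen_lt continuous_const Complex.continuous_re).inter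
      (isOpen_lt Complex.continuous_re continuous_const)
  have hev : F =ᶠ[𝓝 (3 / 4 : ℂ)] Φ := by
    filter_upwards [hstrip.mem_nhds (show (3 / 4 : ℂ) ∈ {z : ℂ | 1 / 2 < z.re ∧ z.re < 1} by
      simp only [Set.mem_setOf_eq]; norm_num)] with z hz
    exact h z hz.1 hz.2
  intro s hs
  exact hFa.eqOn_of_preconnected_of_eventuallyEq hΦa hconn h34 hev hs

/-- `Γ_ℝ` is differentiable where it does not vanish (`1/Γ_ℝ` is entire). [folklore] -/
private theorem differentiableAt_Gammaℝ {z : ℂ} (hz : Gammaℝ z ≠ 0) : DifferentiableAt ℂ Gammaℝ z := by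
  have h := differentiable_Gammaℝ_inv.differentiableAt (x := z)
  have h2 := h.inv (inv_ne_zero hz)
  have h3 : (fun s : ℂ ↦ (Gammaℝ s)⁻¹)⁻¹ = Gammaℝ := by funext s; simp
  have h4 : DifferentiableAt ℂ (fun s : ℂ ↦ (Gammaℝ s)⁻¹)⁻¹ z := h2
  rwa [h3] at h4

/-- The set where `Γ_ℝ ≠ 0` (the complement of `{0, −2, −4, …}`) is open and preconnected. [folklore] -/
private theorem isOpen_isPreconnected_Gammaℝ_ne_zero :
    IsOpen {s : ℂ | Gammaℝ s ≠ 0} ∧ IsPreconnected {s : ℂ | Gammaℝ s ≠ 0} := by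
  constructor
  · have : {s : ℂ | Gammaℝ s ≠ 0} = (fun s : ℂ ↦ (Gammaℝ s)⁻¹) ⁻¹' {0}ᶜ := by
      ext s; simp
    rw [this]
    exact isOpen_compl_singleton.preimage differentiable_Gammaℝ_inv.continuous
  · have hS : ({s : ℂ | Gammaℝ s = 0} : Set ℂ).Countable := by
      refine (Set.countable_range (fun n : ℕ ↦ (-(2 * (n : ℂ)) : ℂ))).mono ?_
      intro s hs
      obtain ⟨n, hn⟩ := Gammaℝ_eq_zero_iff.1 hs
      exact ⟨n, hn.symm⟩
    have h := (hS.isConnected_compl_of_one_lt_rank (by simp)).isPreconnected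
    have hc : ({s : ℂ | Gammaℝ s = 0} : Set ℂ)ᶜ = {s : ℂ | Gammaℝ s ≠ 0} := by ext s; simp
    rwa [hc] at h

/-- For `f ∈ K_a` and ANY entire continuation `G` of `f̂` from the strip: the entire completed
transform is `𝒢_f(s) = Γ_ℝ(s)·G(s)` wherever `Γ_ℝ(s) ≠ 0` (identity theorem on `ℂ ∖ {0,−2,−4,…}`).
[cite: Burnol2004b, Thm. 2.1 (arXiv:math/0203120v7 p. 5, TeX l.437–443)] -/
theorem completedMellinEntire_eq_Gammaℝ_mul {a : ℝ} (ha : 0 < a)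
    {f : Lp ℂ 2 (volume : Measure ℝ)} (hf : f ∈ sonineK a) {G : ℂ → ℂ} (hG : Differentiable ℂ G)
    (hGeq : ∀ s : ℂ, 1 / 2 < s.re → s.re < 1 → G s = rightMellin f s) {s : ℂ}
    (hs : Gammaℝ s ≠ 0) : completedMellinEntire (f : ℝ → ℂ) s = Gammaℝ s * G s := by
  obtain ⟨hMd, hMeq⟩ := hasCompletedMellinEntire_of_mem_sonineK ha hf
  obtain ⟨hUo, hUc⟩ := isOpen_isPreconnected_Gammaℝ_ne_zero
  have h1 : AnalyticOnNhd ℂ (completedMellinEntire (f : ℝ → ℂ)) {s : ℂ | Gammaℝ s ≠ 0} :=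
    hMd.differentiableOn.analyticOnNhd hUo
  have h2 : AnalyticOnNhd ℂ (fun s ↦ Gammaℝ s * G s) {s : ℂ | Gammaℝ s ≠ 0} := by
    refine DifferentiableOn.analyticOnNhd (fun z hz ↦ ?_) hUo
    exact ((differentiableAt_Gammaℝ hz).mul (hG z)).differentiableWithinAt
  have h34 : (3 / 4 : ℂ) ∈ {s : ℂ | Gammaℝ s ≠ 0} :=
    Gammaℝ_ne_zero_of_re_pos (by norm_num)
  have hstrip : IsOpen {z : ℂ | 1 / 2 < z.re ∧ z.re < 1} :=
    (isOpen_lt continuous_const Complex.continuous_re).inter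
      (isOpen_lt Complex.continuous_re continuous_const)
  have hev : completedMellinEntire (f : ℝ → ℂ) =ᶠ[𝓝 (3 / 4 : ℂ)] fun s ↦ Gammaℝ s * G s := by
    filter_upwards [hstrip.mem_nhds (show (3 / 4 : ℂ) ∈ {z : ℂ | 1 / 2 < z.re ∧ z.re < 1} by
      simp only [Set.mem_setOf_eq]; norm_num)] with z hz
    rw [hMeq z hz.1 hz.2, hGeq z hz.1 hz.2]
  exact h1.eqOn_of_preconnected_of_eventuallyEq h2 hUc h34 hev hs

/-- **Lemma 4.4 from clause (ii) of the repaired Prop. 4.1 alone** (clause (i) is the tree theorem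
`Burnol2004b_prop4_1R_i` of `BurnolSonineHardyStrip.lean`; clause (iii) is not used). This is the form
to instantiate with a free-standing proof of clause (ii) (Paley–Wiener in Mellin coordinates).
[cite: Burnol2004b, Lemma 4.4 and its proof (arXiv:math/0203120v7 p. 8, TeX l.746–758)] -/
theorem Burnol2004b_lemma4_4_of_prop4_1R_ii
    (hii : ∀ a : ℝ, 0 < a → ∀ G H : ℂ → ℂ,
      DifferentiableOn ℂ G {s | s ≠ 1} → DifferentiableOn ℂ H {s | s ≠ 1} →
      (∀ s : ℂ, (∀ n : ℕ, s ≠ -2 * (n : ℂ)) → (∀ n : ℕ, s ≠ 1 + 2 * (n : ℂ)) →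
        Gammaℝ s * H s = Gammaℝ (1 - s) * G (1 - s)) →
      (∃ F : ℂ → ℂ, IsHardyRight F ∧ ∀ s : ℂ, 1 / 2 < s.re → s ≠ 1 →
        F s = (a : ℂ) ^ s * ((s - 1) / s) * G s) →
      (∃ F : ℂ → ℂ, IsHardyRight F ∧ ∀ s : ℂ, 1 / 2 < s.re → s ≠ 1 →
        F s = (a : ℂ) ^ s * ((s - 1) / s) * H s) →
      ∃ f ∈ sonineL a, ∀ s : ℂ, 1 / 2 < s.re → s.re < 1 → rightMellin f s = G s) :
    Burnol2004b_lemma4_4 := by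
  intro a ha f hf
  have h41i := Burnol2004b_prop4_1R_i a ha
  have h41ii := hii a ha
  have hfL : f ∈ sonineL a := sonineK_subset_sonineL a hf
  have hFf : (𝓕 f : Lp ℂ 2 (volume : Measure ℝ)) ∈ sonineK a := fourier_mem_sonineK hf
  obtain ⟨G₁, hG₁d, hG₁z, hG₁eq⟩ := (Burnol2004b_thm2_1_holds a ha).1 f hf
  obtain ⟨G₂, hG₂d, hG₂z, hG₂eq⟩ := (Burnol2004b_thm2_1_holds a ha).1 _ hFf
  have hG₁0 : G₁ 0 = 0 := by simpa using hG₁z 0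
  have hopen : IsOpen {s : ℂ | 1 / 2 < s.re} := isOpen_lt continuous_const Complex.continuous_re
  have ha0 : (a : ℂ) ≠ 0 := by exact_mod_cast ha.ne'
  -- `G := G₁(s)/s`, regular at `0`
  set G : ℂ → ℂ := dslope G₁ 0 with hGdef
  have hGd : Differentiable ℂ G := by
    have := (differentiableOn_dslope (Filter.univ_mem : (Set.univ : Set ℂ) ∈ 𝓝 (0 : ℂ))).2
      hG₁d.differentiableOn
    exact differentiableOn_univ.1 this
  have hGval : ∀ s : ℂ, s ≠ 0 → G s = G₁ s / s := by
    intro s hs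
    rw [hGdef, dslope_of_ne _ hs, slope_def_field, hG₁0, sub_zero, sub_zero]
  -- `H := G₂(s)/(1−s)`
  set H : ℂ → ℂ := fun s ↦ G₂ s / (1 - s) with hHdef
  have hHd : DifferentiableOn ℂ H {s | s ≠ 1} := fun s hs ↦
    ((hG₂d s).div ((differentiableAt_const _).sub differentiableAt_id)
      (sub_ne_zero.2 (Ne.symm hs))).differentiableWithinAt
  -- the `Γ_ℝ`-relation from the functional equation on `K_a`
  have hrel : ∀ s : ℂ, (∀ n : ℕ, s ≠ -2 * (n : ℂ)) → (∀ n : ℕ, s ≠ 1 + 2 * (n : ℂ)) →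
      Gammaℝ s * H s = Gammaℝ (1 - s) * G (1 - s) := by
    intro s hs0 hs1
    have hΓ1 : Gammaℝ s ≠ 0 := by
      rw [Ne, Gammaℝ_eq_zero_iff]; push Not; intro n h; exact hs0 n (by rw [h]; ring)
    have hΓ2 : Gammaℝ (1 - s) ≠ 0 := by
      rw [Ne, Gammaℝ_eq_zero_iff]; push Not; intro n h; exact hs1 n (by linear_combination -h)
    have h1s : 1 - s ≠ 0 := sub_ne_zero.2 (fun h ↦ hs1 0 (by simp [← h]))
    have e1 : completedMellinEntire ((𝓕 f : Lp ℂ 2 (volume : Measure ℝ)) : ℝ → ℂ) s =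
        Gammaℝ s * G₂ s := completedMellinEntire_eq_Gammaℝ_mul ha hFf hG₂d hG₂eq hΓ1
    have e2 : completedMellinEntire (f : ℝ → ℂ) (1 - s) = Gammaℝ (1 - s) * G₁ (1 - s) :=
      completedMellinEntire_eq_Gammaℝ_mul ha hf hG₁d hG₁eq hΓ2
    have e3 := congrFun (completedMellinEntire_fourier_eq_of_mem_sonineK ha hf) s
    rw [hHdef, hGval (1 - s) h1s]
    simp only
    rw [mul_div_assoc', mul_div_assoc', ← e1, ← e2, e3]
  -- the `ℍ²` member for `G`
  obtain ⟨F₁, hF₁, hF₁eq⟩ := (h41i f hfL).1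
  have hΦd : DifferentiableOn ℂ (fun s ↦ (a : ℂ) ^ s * ((s - 1) / s) * G₁ s) {s | 1 / 2 < s.re} := by
    intro s hs
    have hs0 : s ≠ 0 := fun h ↦ by simp [h] at hs; linarith [hs]
    exact (((differentiableAt_id.const_cpow (Or.inl ha0)).mul
      ((differentiableAt_id.sub_const 1).div differentiableAt_id hs0)).mul
        (hG₁d s)).differentiableWithinAt
  have hF₁Φ : ∀ s : ℂ, 1 / 2 < s.re → F₁ s = (a : ℂ) ^ s * ((s - 1) / s) * G₁ s :=
    eq_of_eq_on_strip hF₁.1 hΦd (fun s hs hs1 ↦ by rw [hF₁eq s hs hs1, hG₁eq s hs hs1])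
  have hM₁ : ∃ F : ℂ → ℂ, IsHardyRight F ∧ ∀ s : ℂ, 1 / 2 < s.re → s ≠ 1 →
      F s = (a : ℂ) ^ s * ((s - 1) / s) * G s := by
    refine ⟨fun s ↦ F₁ s / s, hF₁.div_id, fun s hs _ ↦ ?_⟩
    have hs0 : s ≠ 0 := fun h ↦ by rw [h, Complex.zero_re] at hs; linarith
    show F₁ s / s = _
    rw [hF₁Φ s hs, hGval s hs0]
    field_simp
  -- the `ℍ²` member for `H`: `−a^s G₂(s)/s = −F₂(s)/(s−1)` off `s = 1`
  obtain ⟨F₂, hF₂, hF₂eq⟩ := (h41i f hfL).2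
  have hΨd : DifferentiableOn ℂ (fun s ↦ (a : ℂ) ^ s * ((s - 1) / s) * G₂ s) {s | 1 / 2 < s.re} := by
    intro s hs
    have hs0 : s ≠ 0 := fun h ↦ by simp [h] at hs; linarith [hs]
    exact (((differentiableAt_id.const_cpow (Or.inl ha0)).mul
      ((differentiableAt_id.sub_const 1).div differentiableAt_id hs0)).mul
        (hG₂d s)).differentiableWithinAt
  have hF₂Ψ : ∀ s : ℂ, 1 / 2 < s.re → F₂ s = (a : ℂ) ^ s * ((s - 1) / s) * G₂ s :=
    eq_of_eq_on_strip hF₂.1 hΨd (fun s hs hs1 ↦ by rw [hF₂eq s hs hs1, hG₂eq s hs hs1])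
  set M₂ : ℂ → ℂ := fun s ↦ -((a : ℂ) ^ s * G₂ s / s) with hM₂def
  have hM₂d : DifferentiableOn ℂ M₂ {s | 1 / 2 < s.re} := by
    intro s hs
    have hs0 : s ≠ 0 := fun h ↦ by simp [h] at hs; linarith [hs]
    exact (((differentiableAt_id.const_cpow (Or.inl ha0)).mul (hG₂d s)).div
      differentiableAt_id hs0).neg.differentiableWithinAt
  have hM₂F : ∀ s : ℂ, 1 / 2 < s.re → s ≠ 1 → M₂ s = -(F₂ s / (s - 1)) := by
    intro s hs hs1
    have hs0 : s ≠ 0 := fun h ↦ by rw [h, Complex.zero_re] at hs; linarith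
    rw [hM₂def, hF₂Ψ s hs]
    simp only
    have : s - 1 ≠ 0 := sub_ne_zero.2 hs1
    field_simp
  have hM₂H : IsHardyRight M₂ := by
    refine hF₂.of_le_off_rect hM₂d (σ₁ := 3 / 4) (σ₂ := 5 / 4) (R := 1) (C := 4)
      (by norm_num) (by norm_num) (by norm_num) (fun s hs hout ↦ ?_)
    have hs1 : s ≠ 1 := by
      rintro rfl
      simp at hout
      rcases hout with h | h | h <;> norm_num at h
    have hdist : 1 / 4 ≤ ‖s - 1‖ := by
      have hre : |(s - 1).re| ≤ ‖s - 1‖ := Complex.abs_re_le_norm _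
      have him : |(s - 1).im| ≤ ‖s - 1‖ := Complex.abs_im_le_norm _
      simp only [Complex.sub_re, Complex.one_re, Complex.sub_im, Complex.one_im, sub_zero] at hre him
      rcases hout with h | h | h
      · have : 1 / 4 ≤ |s.re - 1| := by rw [abs_sub_comm, abs_of_pos (by linarith)]; linarith
        linarith
      · have : 1 / 4 ≤ |s.re - 1| := by rw [abs_of_pos (by linarith)]; linarith
        linarith
      · linarith
    rw [hM₂F s hs hs1, norm_neg, norm_div]
    rw [div_le_iff₀ (by linarith)]
    nlinarith [norm_nonneg (F₂ s), hdist]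
  have hM₂ : ∃ F : ℂ → ℂ, IsHardyRight F ∧ ∀ s : ℂ, 1 / 2 < s.re → s ≠ 1 →
      F s = (a : ℂ) ^ s * ((s - 1) / s) * H s := by
    refine ⟨M₂, hM₂H, fun s hs hs1 ↦ ?_⟩
    have hs0 : s ≠ 0 := fun h ↦ by rw [h, Complex.zero_re] at hs; linarith
    rw [hM₂def, hHdef]
    simp only
    have h1 : s - 1 ≠ 0 := sub_ne_zero.2 hs1
    have h2 : 1 - s ≠ 0 := sub_ne_zero.2 (Ne.symm hs1)
    field_simp
    ring
  -- apply Prop. 4.1 (ii)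
  obtain ⟨h, hh, hheq⟩ := h41ii G H (hGd.differentiableOn) hHd hrel hM₁ hM₂
  refine ⟨h, hh, fun s hs hs1 ↦ ?_⟩
  have hs0 : s ≠ 0 := fun h0 ↦ by rw [h0, Complex.zero_re] at hs; linarith
  rw [hheq s hs hs1, hGval s hs0, hG₁eq s hs hs1]

/-- **Lemma 4.4 from the repaired Prop. 4.1** (the printed proof, TeX l.750–758): for `F = f̂ ∈ K̂_a`,
"`F(s)/s` (which is regular at `s = 0`) belongs to the space `A^s ℍ²`, simply from `1/|s| = O(1)` on
`Re(s) ≥ 1/2`. Its image under the Fourier transform is `𝓕₊(F)(s)/(1−s)` which belongs to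
`(s/(s−1))A^s ℍ²`" — then Prop. 4.1 (ii). Inputs: Thm. 2.1 (`Burnol2004b_thm2_1_holds`: entire
continuation vanishing at `0`), the functional equation on `K_a`
(`completedMellinEntire_fourier_eq_of_mem_sonineK`), `K_a` Fourier-stable (`fourier_mem_sonineK`),
and the `ℍ²` members from clause (i) via `IsHardyRight.div_id` / `IsHardyRight.of_le_off_rect`.
[cite: Burnol2004b, Lemma 4.4 and its proof (arXiv:math/0203120v7 p. 8, TeX l.746–758)] -/
theorem Burnol2004b_lemma4_4_of_prop4_1R (h41 : Burnol2004b_prop4_1R) : Burnol2004b_lemma4_4 :=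
  Burnol2004b_lemma4_4_of_prop4_1R_ii (fun a ha ↦ (h41 a ha).2.1)

/-! ## Poles at `s = 1` and the constants on `(0,a)`: a `K_a`-membership criterion -/

/-- **A pole at `s = 1` detects the constant on `(0,a)`**: if `f ∈ L²(ℝ)` equals `c` a.e. on `(0,a)` and
its right Mellin transform on the strip `1/2 < Re s < 1` agrees with a function `G` continuous at
`s = 1`, then `c = 0` — since `f̂(s) = c·a^{1−s}/(1−s) + (holomorphic near 1)` (the Mellin image of
`ℂ·𝟙_{0<t<a} + L²(a,∞;dt)` is `(s/(s−1))A^sℍ²`, TeX l.638–643: the factor `s/(s−1)` carries exactly the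
constants). Used to read off `K_a`-membership (`f` AND `𝓕f` vanishing on `(0,a)`) from pole-free Mellin
data. [cite: Burnol2004b, §4 before Prop. 4.1 (arXiv:math/0203120v7 p. 7, TeX l.632–643)] -/
theorem const_eq_zero_of_continuousAt {a : ℝ} (ha : 0 < a) {f : ℝ → ℂ}
    (hf : MemLp f 2 (volume : Measure ℝ)) {c : ℂ} (hfc : ∀ᵐ x : ℝ, x ∈ Ioo 0 a → f x = c)
    {G : ℂ → ℂ} (hG : ContinuousAt G 1)
    (hGeq : ∀ s : ℂ, 1 / 2 < s.re → s.re < 1 → G s = rightMellin f s) : c = 0 := by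
  by_contra hc
  have ha0 : (a : ℂ) ≠ 0 := by exact_mod_cast ha.ne'
  set g : ℝ → ℂ := (Ioi a).indicator f with hgdef
  have hg : MemLp g 2 (volume : Measure ℝ) := hf.indicator measurableSet_Ioi
  have h0 : ∀ x : ℝ, x ≤ a → g x = 0 :=
    fun x hx ↦ indicator_of_notMem (show x ∉ Ioi a from not_lt.2 hx) f
  have hT := Burnol2004bHardyStrip.isHardyRight_cpow_mul_mellin ha hg h0
  have hopen : IsOpen {s : ℂ | 1 / 2 < s.re} := isOpen_lt continuous_const Complex.continuous_re
  have h1mem : (1 : ℂ) ∈ {s : ℂ | 1 / 2 < s.re} := by simp; norm_num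
  -- `T(s) = mellin g (1 − s)` is continuous at `1`
  have hTc : ContinuousAt (fun s : ℂ ↦ mellin g (1 - s)) 1 := by
    have h1 : ContinuousAt (fun s : ℂ ↦ (a : ℂ) ^ s * mellin g (1 - s)) 1 :=
      ((hT.1 1 h1mem).differentiableAt (hopen.mem_nhds h1mem)).continuousAt
    have h2 : ContinuousAt (fun s : ℂ ↦ ((a : ℂ) ^ s)⁻¹) 1 :=
      (continuousAt_const_cpow ha0).inv₀ (cpow_ne_zero_iff_of_exponent_ne_zero one_ne_zero |>.2 ha0)
    have h3 : ContinuousAt (fun s : ℂ ↦ ((a : ℂ) ^ s)⁻¹ * ((a : ℂ) ^ s * mellin g (1 - s))) 1 :=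
      h2.mul h1
    have heq : (fun s : ℂ ↦ ((a : ℂ) ^ s)⁻¹ * ((a : ℂ) ^ s * mellin g (1 - s))) =
        fun s : ℂ ↦ mellin g (1 - s) := by
      funext s
      have : (a : ℂ) ^ s ≠ 0 := by
        rw [Ne, cpow_eq_zero_iff]; exact fun h ↦ ha0 h.1
      field_simp
    rwa [heq] at h3
  have hD : ContinuousAt (fun s : ℂ ↦ G s - mellin g (1 - s)) 1 := hG.sub hTc
  -- boundedness near `1`
  set B : ℝ := ‖G 1 - mellin g (1 - 1)‖ + 1 with hB
  have hB0 : 0 < B := by rw [hB]; positivity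
  obtain ⟨δ, hδ, hbd⟩ : ∃ δ > 0, ∀ s : ℂ, dist s 1 < δ → ‖G s - mellin g (1 - s)‖ ≤ B := by
    obtain ⟨δ, hδ, h⟩ := Metric.continuousAt_iff.1 hD 1 one_pos
    refine ⟨δ, hδ, fun s hs ↦ ?_⟩
    have h1 := h hs
    rw [dist_eq_norm] at h1
    have h2 := norm_le_norm_add_norm_sub' (G s - mellin g (1 - s)) (G 1 - mellin g (1 - 1))
    rw [hB]; linarith
  -- a lower bound `a^t ≥ m` for `0 ≤ t ≤ 1`
  set m : ℝ := min a 1 with hm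
  have hm0 : 0 < m := lt_min ha one_pos
  have hapow : ∀ t : ℝ, 0 ≤ t → t ≤ 1 → m ≤ a ^ t := by
    intro t ht0 ht1
    rcases le_or_gt 1 a with ha1 | ha1
    · exact (min_le_right _ _).trans (Real.one_le_rpow ha1 ht0)
    · calc m ≤ a := min_le_left _ _
        _ = a ^ (1 : ℝ) := (Real.rpow_one a).symm
        _ ≤ a ^ t := Real.rpow_le_rpow_of_exponent_ge ha ha1.le ht1
  -- choose a real point `s = 1 − t` of the strip close to `1`
  set t : ℝ := min (δ / 2) (min (1 / 4) (‖c‖ * m / (2 * B))) with ht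
  have hc0 : 0 < ‖c‖ := norm_pos_iff.2 hc
  have ht0 : 0 < t := by rw [ht]; exact lt_min (by linarith) (lt_min (by norm_num) (by positivity))
  have htδ : t < δ := lt_of_le_of_lt (min_le_left _ _) (by linarith)
  have ht4 : t ≤ 1 / 4 := (min_le_right _ _).trans (min_le_left _ _)
  have htc : t ≤ ‖c‖ * m / (2 * B) := (min_le_right _ _).trans (min_le_right _ _)
  set s : ℂ := ((1 - t : ℝ) : ℂ) with hs
  have hsre : s.re = 1 - t := by simp [hs]
  have hs1 : 1 / 2 < s.re := by rw [hsre]; linarith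
  have hs2 : s.re < 1 := by rw [hsre]; linarith
  have hdist : dist s 1 < δ := by
    rw [dist_eq_norm, hs]
    have : ((1 - t : ℝ) : ℂ) - 1 = ((-t : ℝ) : ℂ) := by push_cast; ring
    rw [this, Complex.norm_real, Real.norm_eq_abs, abs_neg, abs_of_pos ht0]
    exact htδ
  -- on the strip: `G s − T s = c a^{1−s}/(1−s)`
  have hdec := rightMellin_eq_of_ae_eq_const ha f hf hfc hs1 hs2
  have h1s : (1 : ℂ) - s = (t : ℂ) := by rw [hs]; push_cast; ring
  have hDs : G s - mellin g (1 - s) = c * (a : ℂ) ^ (t : ℂ) / (t : ℂ) := by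
    rw [hGeq s hs1 hs2, hdec, ← hgdef, h1s]; ring
  have hnorm : ‖G s - mellin g (1 - s)‖ = ‖c‖ * a ^ t / t := by
    rw [hDs, norm_div, norm_mul, Complex.norm_real, Real.norm_of_nonneg ht0.le,
      Complex.norm_cpow_eq_rpow_re_of_pos ha]
    simp
  -- contradiction: `‖c‖ a^t / t ≥ ‖c‖ m / t ≥ 2B > B`
  have hle := hbd s hdist
  rw [hnorm] at hle
  have hge : ‖c‖ * m / t ≤ ‖c‖ * a ^ t / t := by
    gcongr
    exact hapow t ht0.le (by linarith)
  have h2B : 2 * B ≤ ‖c‖ * m / t := by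
    rw [le_div_iff₀ ht0]
    have := (le_div_iff₀ (by positivity : (0:ℝ) < 2 * B)).1 htc
    linarith
  linarith

/-- **`K_a`-membership from pole-free Mellin data**: an element `f` of `L_a` whose right Mellin
transform and whose Fourier transform's right Mellin transform both agree on the strip with functions
continuous at `s = 1` lies in `K_a` (both constants on `(0,a)` vanish).
[cite: Burnol2004b, §4 before Prop. 4.1 and §2 (arXiv:math/0203120v7 pp. 5, 7; TeX l.423–434, 632–643)] -/
theorem mem_sonineK_of_continuousAt {a : ℝ} (ha : 0 < a) {f : Lp ℂ 2 (volume : Measure ℝ)}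
    (hf : f ∈ sonineL a) {G H : ℂ → ℂ} (hG : ContinuousAt G 1)
    (hGeq : ∀ s : ℂ, 1 / 2 < s.re → s.re < 1 → G s = rightMellin f s)
    (hH : ContinuousAt H 1)
    (hHeq : ∀ s : ℂ, 1 / 2 < s.re → s.re < 1 →
      H s = rightMellin (𝓕 f : Lp ℂ 2 (volume : Measure ℝ)) s) :
    f ∈ sonineK a := by
  obtain ⟨heven, ⟨c, hc⟩, ⟨c', hc'⟩⟩ := hf
  have h1 : c = 0 := const_eq_zero_of_continuousAt ha (Lp.memLp f) hc hG hGeq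
  have h2 : c' = 0 := const_eq_zero_of_continuousAt ha (Lp.memLp _) hc' hH hHeq
  subst h1; subst h2
  exact ⟨heven, hc, hc'⟩

/-! ## Prop. 4.5: `dim L_a/K_a = 2` from two vectors with independent constant pairs -/

/-- An a.e. statement on the interval `(0,a)` of positive length about a CONSTANT proposition holds.
[folklore] -/
private theorem of_ae_Ioo {a : ℝ} (ha : 0 < a) {P : Prop}
    (h : ∀ᵐ x : ℝ, x ∈ Ioo 0 a → P) : P := by
  by_contra hP
  have h' : ∀ᵐ x : ℝ, x ∉ Ioo 0 a := by
    filter_upwards [h] with x hx hxI using hP (hx hxI)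
  have h0 : volume (Ioo (0 : ℝ) a) = 0 := measure_eq_zero_iff_ae_notMem.2 h'
  rw [Real.volume_Ioo] at h0
  have : ENNReal.ofReal (a - 0) ≠ 0 := by simpa using ha
  exact this h0

/-- **Prop. 4.5 (`dim L_a/K_a = 2`) from two vectors of `L_a` with independent constant pairs** — the
bookkeeping half of the printed proof: "`K_a` is defined by two linear conditions" in `L_a` (the
constants of `f` and of `𝓕₊f` on `(0,a)`), so `dim(L_a/K_a) ≤ 2`, with equality as soon as two elements
`u, v ∈ L_a` have linearly independent pairs of constants `(c_u, c'_u)`, `(c_v, c'_v)` (Burnol obtains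
them from an `F ∈ K̂_a` with `F'(0) ≠ 0` through Lemma 4.4 — that existence is the INPUT here).
[cite: Burnol2004b, Prop. 4.5 and its proof (arXiv:math/0203120v7 p. 9, TeX l.760–776)] -/
theorem Burnol2004b_prop4_5_of_exists_pair
    (h : ∀ a : ℝ, 0 < a → ∃ u ∈ sonineL a, ∃ v ∈ sonineL a, ∃ cu cu' cv cv' : ℂ,
      (∀ᵐ x : ℝ, x ∈ Ioo 0 a → u x = cu) ∧
      (∀ᵐ x : ℝ, x ∈ Ioo 0 a → (𝓕 u : Lp ℂ 2 (volume : Measure ℝ)) x = cu') ∧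
      (∀ᵐ x : ℝ, x ∈ Ioo 0 a → v x = cv) ∧
      (∀ᵐ x : ℝ, x ∈ Ioo 0 a → (𝓕 v : Lp ℂ 2 (volume : Measure ℝ)) x = cv') ∧
      cu * cv' - cv * cu' ≠ 0) :
    Burnol2004b_prop4_5 := by
  intro a ha
  obtain ⟨u, hu, v, hv, cu, cu', cv, cv', hcu, hcu', hcv, hcv', hdet⟩ := h a ha
  refine ⟨u, hu, v, hv, ?_, ?_⟩
  · -- independence modulo `K_a`
    intro c d hw
    obtain ⟨-, hw0, hw1⟩ := hw
    have e1 : c * cu + d * cv = 0 := by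
      refine of_ae_Ioo ha ?_
      filter_upwards [hw0, hcu, hcv, Lp.coeFn_add (c • u) (d • v), Lp.coeFn_smul c u,
        Lp.coeFn_smul d v] with x h0 h1 h2 hadd hsu hsv hx
      have := h0 hx
      rw [hadd, Pi.add_apply, hsu, hsv, Pi.smul_apply, Pi.smul_apply, h1 hx, h2 hx,
        smul_eq_mul, smul_eq_mul] at this
      exact this
    have e2 : c * cu' + d * cv' = 0 := by
      refine of_ae_Ioo ha ?_
      have hF : (𝓕 (c • u + d • v) : Lp ℂ 2 (volume : Measure ℝ)) =
          c • (𝓕 u : Lp ℂ 2 (volume : Measure ℝ)) + d • (𝓕 v : Lp ℂ 2 (volume : Measure ℝ)) := by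
        rw [FourierAdd.fourier_add, FourierSMul.fourier_smul, FourierSMul.fourier_smul]
      rw [hF] at hw1
      filter_upwards [hw1, hcu', hcv',
        Lp.coeFn_add (c • (𝓕 u : Lp ℂ 2 (volume : Measure ℝ))) (d • (𝓕 v : Lp ℂ 2 (volume : Measure ℝ))),
        Lp.coeFn_smul c (𝓕 u : Lp ℂ 2 (volume : Measure ℝ)),
        Lp.coeFn_smul d (𝓕 v : Lp ℂ 2 (volume : Measure ℝ))] with x h0 h1 h2 hadd hsu hsv hx
      have := h0 hx
      rw [hadd, Pi.add_apply, hsu, hsv, Pi.smul_apply, Pi.smul_apply, h1 hx, h2 hx,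
        smul_eq_mul, smul_eq_mul] at this
      exact this
    constructor
    · have : c * (cu * cv' - cv * cu') = 0 := by linear_combination cv' * e1 - cv * e2
      exact (mul_eq_zero.1 this).resolve_right hdet
    · have : d * (cu * cv' - cv * cu') = 0 := by linear_combination cu * e2 - cu' * e1
      exact (mul_eq_zero.1 this).resolve_right hdet
  · -- spanning modulo `K_a`
    intro f hf
    obtain ⟨hfe, ⟨cf, hcf⟩, ⟨cf', hcf'⟩⟩ := hf
    set D : ℂ := cu * cv' - cv * cu' with hD
    set c : ℂ := (cf * cv' - cv * cf') / D with hc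
    set d : ℂ := (cu * cf' - cf * cu') / D with hd
    have hsol1 : c * cu + d * cv = cf := by
      rw [hc, hd]; field_simp; ring
    have hsol2 : c * cu' + d * cv' = cf' := by
      rw [hc, hd]; field_simp; ring
    refine ⟨c, d, ?_, ?_, ?_⟩
    · -- evenness
      have e : f - c • u - d • v = f + (-c) • u + (-d) • v := by
        simp only [neg_smul, sub_eq_add_neg]
      rw [e]
      exact add_mem_evenL2 (add_mem_evenL2 hfe (smul_mem_evenL2 _ hu.1)) (smul_mem_evenL2 _ hv.1)
    · filter_upwards [hcf, hcu, hcv, Lp.coeFn_sub (f - c • u) (d • v), Lp.coeFn_sub f (c • u),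
        Lp.coeFn_smul c u, Lp.coeFn_smul d v] with x h0 h1 h2 hs1 hs2 hsu hsv hx
      rw [hs1, Pi.sub_apply, hs2, Pi.sub_apply, hsu, hsv, Pi.smul_apply, Pi.smul_apply, h0 hx,
        h1 hx, h2 hx, smul_eq_mul, smul_eq_mul, ← hsol1]
      ring
    · have hF : (𝓕 (f - c • u - d • v) : Lp ℂ 2 (volume : Measure ℝ)) =
          (𝓕 f : Lp ℂ 2 (volume : Measure ℝ)) - c • (𝓕 u : Lp ℂ 2 (volume : Measure ℝ)) -
            d • (𝓕 v : Lp ℂ 2 (volume : Measure ℝ)) := by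
        simp only [sub_eq_add_neg, ← neg_smul, FourierAdd.fourier_add, FourierSMul.fourier_smul]
      rw [hF]
      filter_upwards [hcf', hcu', hcv',
        Lp.coeFn_sub ((𝓕 f : Lp ℂ 2 (volume : Measure ℝ)) - c • (𝓕 u : Lp ℂ 2 (volume : Measure ℝ)))
          (d • (𝓕 v : Lp ℂ 2 (volume : Measure ℝ))),
        Lp.coeFn_sub (𝓕 f : Lp ℂ 2 (volume : Measure ℝ)) (c • (𝓕 u : Lp ℂ 2 (volume : Measure ℝ))),
        Lp.coeFn_smul c (𝓕 u : Lp ℂ 2 (volume : Measure ℝ)),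
        Lp.coeFn_smul d (𝓕 v : Lp ℂ 2 (volume : Measure ℝ))] with x h0 h1 h2 hs1 hs2 hsu hsv hx
      rw [hs1, Pi.sub_apply, hs2, Pi.sub_apply, hsu, hsv, Pi.smul_apply, Pi.smul_apply, h0 hx,
        h1 hx, h2 hx, smul_eq_mul, smul_eq_mul, ← hsol2]
      ring

end BurnolSonineHardy

end Literature.NumberTheory.LFunctions

end
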